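import Literature.MathematicalPhysics.QuantumFieldTheory.BalabanImbrieJaffe1984to88.BIJ88Eq596Frame
import Literature.MathematicalPhysics.QuantumFieldTheory.BalabanImbrieJaffe1984to88.BIJ88GaugeSummary5512
import Literature.MathematicalPhysics.QuantumFieldTheory.BalabanImbrieJaffe1984to88.BIJ88ScalarSummary583
import Literature.MathematicalPhysics.QuantumFieldTheory.BalabanImbrieJaffe1984to88.BIJ88Eq5613Summary
import Literature.MathematicalPhysics.QuantumFieldTheory.BalabanImbrieJaffe1984to88.BIJ88PertQ5715

/-!
# `BalabanImbrieJaffe1984to88.BIJ88Eq596SlotsByName` — T. Bałaban, J. Imbrie, A. Jaffe, *Effective action and cluster properties of the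
abelian Higgs model*, Commun. Math. Phys. **114** (1988) 257–315 [BalabanImbrieJaffe1988], **(5.9.6)** p. 297 [PDF 41] with **(5.3.5)** p. 280,
**(5.5.12)** p. 285 and **(5.8.3)** p. 296: *"Let us summarize the operations performed so far by using the concluding formulae in the last
several sections"* — **THE FOURTEEN EXPONENT ENTRIES OF (5.9.6) THAT (5.5.12) AND (5.8.3) PRODUCE, FILLED FROM THE OPERATOR DICTIONARIES OF
RECORD, AND THOSE TWO CONCLUDING FORMULAE FED BY NAME.**

statement-level skeleton of published theorems with citation tags; proofs where landed; nothing here is a claim about the Yang–Mills mass gap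

WHAT THIS FILE DOES (row `C2.Eq5.9.6` of `HOME/lit-balaban-r16/ROWS-C2-part2.md`, owner r16, flip item *"`h59` slot by slot BY NAME"*; companion
of this seat's `BIJ88Eq596Sectors`, whose `h59_of_sectors` reduces the pointwise identity `h59` of the (5.9.6) frame to displayed sector
identities (G) = (5.3.5)+(5.5.12), (S) = (5.4.6)+(5.6.13)+(5.8.3), (Z), (C) on the transcribed table `BIJ88Eq596Frame.Bracket596`).
The tree holds (5.3.5), (5.5.12) and (5.8.3) as PROVED identities on abstract real inner-product carriers — p02's
`BIJ88GaugeSummary5512.Ops.eq535_end` (*"½⟨Λ₅^{(k−1)′**}f^{(k)}, σ_{k,loc}Λ₅^{(k−1)′**}f^{(k)}⟩ = 𝒬₁ + 𝒬′₁"*), `Ops.eq5512` (*"= 𝒬₁ + ½⟨Λ₁^{(k)**}∂A^{(k)},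
σ_{k,loc}Λ₁^{(k)**}∂A^{(k)}⟩ + ½⟨Λ₅^{(k)′**}f, σ^L_{k+1,loc}Λ₅^{(k)′**}f⟩ + 𝒬₂ + 𝒬₃ + ⟨f, w₃A^{(k)}⟩ + ½⟨f, w₄f⟩. (5.5.12)"*) and
`BIJ88ScalarSummary583.Ops.eq583` (*"½⟨Λ₈^{(k−1)′}φ, Δ_{k,loc}(ũ_{k+1})Λ₈^{(k−1)′}φ⟩ + ½aL⁻²⟨ψ − Q(ũ_{k+1})φ, ψ − Q(ũ_{k+1})φ⟩ = 𝒬₄ + 𝒬₅ + 𝒬₆ +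
½⟨Λ₈^{(k−1)′}φ^{(k)}, (Δ_{k,loc}(ũ_{k+1}) + aL⁻²P(ũ_{k+1}))Λ₈^{(k−1)′}φ^{(k)}⟩ + ½⟨Λ₈^{(k)″}ψ, Δ^L_{k+1,loc}(u_{k+1})Λ₈^{(k)′}ψ⟩ + ⟨φ^{(k)}, w₆ψ⟩ + ½⟨ψ, w₇ψ⟩,
(5.8.3)"*, at `φ = φ^{(k)} + Tψ`, `T` = the (5.8.1) shift).  Here:
* §1 **(G) by name.**  A `GaugeReading` = per term p02's §5.5 dictionary `BIJ88GaugeSummary5512.Ops M` (regions `Λ_i` of the term, the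
  background-independent abelian kernels `σ_{k,loc}`, `σ^L_{k+1,loc}`, `C^{(k)}_{loc}`, `H_{k,loc}`, …) + READING MAPS of the configuration into
  the carrier `M`: `rg` (the outside part `Λ₁^{(k)**c}(ie_k)⁻¹log u(p)v(p′₀)` of (5.3.2)), `rA` (`A^{(k)}`, the logarithm of the translated gauge
  variable), `rf` (`f = (ie_k)⁻¹log v(p)`).  The seven (5.9.6) entries `𝒬₁`, `⟨Λ₁**∂A, σ_{k,loc}Λ₁**∂A⟩`, `⟨Λ₅′**f, σ^Lf⟩`, `𝒬₂`, `𝒬₃`, `⟨f, w₃A⟩`,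
  `⟨f, w₄f⟩` and the intermediate `𝒬′₁` are DEFINED from the dictionary at the read configuration (`gQ1`, `gQuadA`, …, `gQ1'`), and the two
  printed steps of (G) HOLD BY NAME: `h535_byName` (= `eq535_end`), `h5512_byName` (= `eq5512` − `eq535_end`), in exactly the hypothesis shapes
  `h535`/`h5512` of `BIJ88Eq596Sectors.hG_of_steps` — the first modulo the ONE reading identity `hread : ½·gaugeForm (T t) (cfg u) =
  ½⟪Λ₅′**f^{(k)}_{read}, σ_{k,loc}Λ₅′**f^{(k)}_{read}⟫` ((5.3.2): r18's plaquette double sum of (4.1) read in the log coordinates on the carrier —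
  the content of row C2.Eq5.3.1-5.3.7, displayed).
* §2 **(5.8.3) by name.**  A `ScalarReading` = per term AND per gauge configuration (the operators `Δ_{k,loc}(ũ_{k+1})`, `P(ũ_{k+1})`,
  `C^{(k)}_{loc}(u_{k+1})`, `Q(ũ_{k+1})` depend on the backgrounds, functions of `(u^{(k)}, v)`) p02's §5.8 dictionary
  `BIJ88ScalarSummary583.Ops M N F` + reading maps `rφ` (`φ^{(k)}` into `M`), `rψ` (`ψ` into `N`).  The seven entries `𝒬₄`, `𝒬₅`, `𝒬₆`,
  `⟨Λ₈′φ^{(k)}, (Δ + aL⁻²P)Λ₈′φ^{(k)}⟩`, `⟨Λ₈′ψ, Δ^LΛ₈′ψ⟩`, `⟨φ^{(k)}, w₆ψ⟩`, `⟨ψ, w₇ψ⟩` and the intermediate `mid2` (= the scalar quadratic forms at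
  `φ = φ^{(k)} + Tψ`, the (5.8.1) shift `T` of the dictionary: `Ops.T`) are DEFINED (`sQ4`, …, `sMid2`), and `h583_byName` (= `eq583`) holds in
  exactly the shape `h583` of `BIJ88Eq596Sectors.hS_of_steps`.
* §3 `fillOps D RG RS` = the table `D` with these fourteen entries filled; `h535_fillOps`, `h5512_fillOps`, `h583_fillOps`.
* §4 (v1.1) **(5.6.13) by name.**  An `ExpansionReading` = p31's Taylor bookkeeping of Sect. 5.6 at the configuration (the physical value
  `Sphys` of the three scalar expressions, their interpolating family `F(e′)` of (5.6.14), the order `n̄`, the localization correction `δR`);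
  the entries `R^{(k)}` := `R̃^{(k)} − δR` (`Rtilde`) and `Σ_□W₁` := p31's `W1` are DEFINED (`eRk`, `eW1`) and `h5613_byName` (= p31's
  `BIJ88Eq5613Summary.eq5613`) holds in the shape `h5613` of `BIJ88Eq596Sectors.hS_of_steps`, modulo the ONE reading identity `hreadS : F 0 =
  mid2 + 𝒫_{k,loc}(ũ_{k+1})` (the expressions at `e′ = 0` are the (5.8.1)-read forms plus the interaction entry).
* §5 (v1.1) **(5.7.13) by name.**  A `ZReading` = per previous step `j < k` p13's smooth family of positive Gaussian quadratic forms `M_j(e′)` at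
  the configuration (`BIJ88PertQ5715.Zloc`), the numerical factors `Z^{(j)}_v` and the order `n̄`; the entries `Π[Z_vZ(u_{k+1})]` := `Π_jZ^{(j)}_vZ_j(0)`
  and `Q^{(k)} + ΣW₂` := `Σ_j(pertQ5715 + remW5713)` are DEFINED (`zZf`, `zQW`) and `h5713_byName` (= p13's `eq5713_main_of_entries`, factor by
  factor: `M_j` positive definite on `[0,1]` with `C^{n̄+1}` entries) holds in the shape `h5713` of `BIJ88Eq596Sectors.hZ_of_steps` with `Zmid :=
  Π_jZ^{(j)}_vZ_j(1)` — the gauge-away reading `hgauge` of `hZ_of_steps` (p. 283) stays displayed.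
WHAT REMAINS DISPLAYED for (5.9.6) after this file and `BIJ88Eq596Sectors` — every printed ALGEBRAIC step of `h59` now entering by name —
is READINGS ONLY (one line each, each the content of its own row): `hread` (5.3.2) (C2.Eq5.3.1-5.3.7); the rotation `h546` (5.4.5)–(5.4.6)
(C2.Eq5.4.1-5.4.6: gauge covariance of the (4.1) slots — r18 `gaussWeight_twist`, p34 g7 `qCov_barU_gaugeAct`, p31 `scalarForm_sum_gaugeAct`
for the concrete objects); `hreadS` (the (5.8.1) reading of the forms at `ũ_{k+1}`); `hgauge` (p. 283 gauge-away of the normalization factors);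
(C) the Sect. 5.9 support claim (C2.Eq5.9.1-5.9.5); and the dictionaries' `Laws`/positivity/smoothness inputs (p02/p13's displayed data).

HONEST SCOPE.  Pure instantiation: no new analysis, no bound; the reading maps and dictionaries are DATA (their torus instances are the
business of rows 5.3/5.5/5.8 — p31's torus files); the carriers are p02's abstract real inner-product spaces.  Definitions with bodies
(`GaugeReading`, `ScalarReading`, `ExpansionReading`, `ZReading`, the fillers, `fillOps`) and theorems; 0 `sorry`; NO `Prop`-valued fact;
imports this seat's `BIJ88Eq596Frame`, p02's `BIJ88GaugeSummary5512`/`BIJ88ScalarSummary583`, p31's `BIJ88Eq5613Summary`, p13's `BIJ88PertQ5715`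
(Literature + Mathlib); standard axioms.  Pages re-read as images this session: p. 280 [PDF 24], p. 285 [PDF 29], p. 288 [PDF 32], p. 295
[PDF 39], p. 296 [PDF 40], p. 297 [PDF 41].  v1.1 = v1.0 (p329337) + §§4–5 appended + two imports; every v1.0 declaration unchanged.  Seat p34 gen 13 (unit `lit-balaban-p34-g13`;
TAKING line HOME/STATUS.md 2026-08-22T12:11:44Z).
-/

open scoped RealInnerProductSpace

namespace Literature.MathematicalPhysics.QuantumFieldTheory.BalabanImbrieJaffe1984to88.BIJ88Eq596SlotsByName

open Literature.MathematicalPhysics.QuantumFieldTheory.Balaban1983to89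
open BIJ88Sect3Statements (U1)
open BIJ85Sect1Model (HiggsField)
open BIJ88RenormTransf311 (DeltaAx)
open BIJ88InductiveForm41 (Prev)
open BIJ88Eq596Frame (Entry Bracket596)
open BIJ88ScalarTransl582 (scalarForms Q4)
open scoped BigOperators

noncomputable section

variable {P : Params} {k : ℕ} {ι : Type*}

/-! ## §1 (G): the gauge-sector entries from p02's §5.5 dictionary; (5.3.5) and (5.5.12) by name -/

section Gauge

variable {M : Type*} [NormedAddCommGroup M] [InnerProductSpace ℝ M]

variable (P k ι M) in
/-- **A reading of the gauge-field data of a term into p02's §5.5 dictionary**: the dictionary `O t` of the term (its regions `Λ₁^{(k)**}`,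
`Λ₂`, `Λ₄^{(k)*}`, `Λ₅^{(k)′**}`, `Λ₅^{(k−1)′**}`, … and the abelian kernels `σ_{k,loc}`, `σ^L_{k+1,loc}`, `C^{(k)}_{loc}`, `H_{k,loc}`, `𝒟_{k,loc}`, …, all
background-independent), and the maps reading a configuration `({u^{(j)}}, u^{(k)}, v)` into the carrier: `rg` = the outside part
`Λ₁^{(k)**c}(ie_k)⁻¹log u(p)v(p′₀)` of (5.3.2), `rA` = `A^{(k)}` (`u^{(k)}_b = e^{ie_kA^{(k)}_b}`), `rf` = `f`, *"f(p) = (ie_k)⁻¹ log v(p)"* (p. 280).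
[cite: BalabanImbrieJaffe1988, (5.3.2) p.280] -/
structure GaugeReading where
  /-- the §5.5 operator dictionary of the term -/
  O : ι → BIJ88GaugeSummary5512.Ops M
  /-- `g`: the part of `f^{(k)}` outside `Λ₁^{(k)**}`, read on the carrier -/
  rg : ι → Prev P k → GaugeField P k U1 → GaugeField P (k+1) U1 → M
  /-- `A^{(k)}`, read on the carrier -/
  rA : ι → Prev P k → GaugeField P k U1 → GaugeField P (k+1) U1 → M
  /-- `f`, read on the carrier -/
  rf : ι → Prev P k → GaugeField P k U1 → GaugeField P (k+1) U1 → M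

variable (R : GaugeReading P k ι M)

/-- `A′ = A^{(k)} − Sf` — the argument of `f^{(k)}` after the second translation (5.5.2) (p02's `Ops.S`), read.
[cite: BalabanImbrieJaffe1988, (5.5.2) p.283] -/
def rA' (t : ι) (prev : Prev P k) (u' : GaugeField P k U1) (v : GaugeField P (k+1) U1) : M :=
  R.rA t prev u' v - (R.O t).S (R.rf t prev u' v)

/-- **`f^{(k)}` read on the carrier after both translations**: `Λ₁**ᶜg + Λ₁**(∂A′ + L⁻²Q^{e*}f)`, `A′ = A^{(k)} − Sf` ((5.3.2) with (5.5.2); p02's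
`Ops.fkTot`). [cite: BalabanImbrieJaffe1988, (5.3.2) p.280] -/
def rfk (t : ι) (prev : Prev P k) (u' : GaugeField P k U1) (v : GaugeField P (k+1) U1) : M :=
  (R.O t).fkTot (R.rg t prev u' v) (rA' R t prev u' v) (R.rf t prev u' v)

/-- **the left side of (5.3.5) on the carrier**: `½⟨Λ₅^{(k−1)′**}f^{(k)}, σ_{k,loc}Λ₅^{(k−1)′**}f^{(k)}⟩` at the read configuration.
[cite: BalabanImbrieJaffe1988, (5.3.5) p.280] -/
def gLHS (t : ι) (prev : Prev P k) (u' : GaugeField P k U1) (v : GaugeField P (k+1) U1) : ℝ :=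
  (1 / 2) * ⟪(R.O t).Λ5p (rfk R t prev u' v), (R.O t).σloc ((R.O t).Λ5p (rfk R t prev u' v))⟫

/-- entry `𝒬₁` of (5.9.6) ((5.3.5); p02's `Ops.Q1`), read. [cite: BalabanImbrieJaffe1988, (5.3.5) p.280] -/
def gQ1 : Entry P k ι ℝ := fun t prev u' v _ _ =>
  (R.O t).Q1 (R.rg t prev u' v) ((R.O t).fk (rA' R t prev u' v) (R.rf t prev u' v))

/-- the intermediate `𝒬′₁` of (5.3.5) (p02's `Ops.Q1'`), read. [cite: BalabanImbrieJaffe1988, (5.3.5) p.280] -/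
def gQ1' : Entry P k ι ℝ := fun t prev u' v _ _ => (R.O t).Q1' (rA' R t prev u' v) (R.rf t prev u' v)

/-- entry `⟨Λ₁^{(k)**}∂A^{(k)}, σ_{k,loc}Λ₁^{(k)**}∂A^{(k)}⟩` of (5.9.6) ((5.5.3)), read. [cite: BalabanImbrieJaffe1988, (5.5.3) p.284] -/
def gQuadA : Entry P k ι ℝ := fun t prev u' v _ _ =>
  ⟪(R.O t).Λ1 ((R.O t).d (R.rA t prev u' v)), (R.O t).σloc ((R.O t).Λ1 ((R.O t).d (R.rA t prev u' v)))⟫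

/-- entry `⟨Λ₅^{(k)′**}f, σ^L_{k+1,loc}Λ₅^{(k)′**}f⟩` of (5.9.6) ((5.5.12)), read. [cite: BalabanImbrieJaffe1988, (5.5.12) p.285] -/
def gQuadF : Entry P k ι ℝ := fun t prev u' v _ _ =>
  ⟪(R.O t).Λ5 (R.rf t prev u' v), (R.O t).σL ((R.O t).Λ5 (R.rf t prev u' v))⟫

/-- entry `𝒬₂` of (5.9.6) ((5.5.9); p02's `Ops.Q2`), read. [cite: BalabanImbrieJaffe1988, (5.5.9) p.284] -/
def gQ2 : Entry P k ι ℝ := fun t prev u' v _ _ => (R.O t).Q2 (R.rA t prev u' v) (R.rf t prev u' v)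

/-- entry `𝒬₃` of (5.9.6) ((5.5.12); p02's `Ops.Q3`), read. [cite: BalabanImbrieJaffe1988, (5.5.12) p.285] -/
def gQ3 : Entry P k ι ℝ := fun t prev u' v _ _ => (R.O t).Q3 (R.rf t prev u' v)

/-- entry `⟨f, w₃A^{(k)}⟩` of (5.9.6) ((5.5.8); p02's `Ops.w3form`), read. [cite: BalabanImbrieJaffe1988, (5.5.8) p.284] -/
def gW3 : Entry P k ι ℝ := fun t prev u' v _ _ => (R.O t).w3form (R.rA t prev u' v) (R.rf t prev u' v)

/-- entry `⟨f, w₄f⟩` of (5.9.6) ((5.5.12); p02's `Ops.w4form`, explicit), read. [cite: BalabanImbrieJaffe1988, (5.5.12) p.285] -/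
def gW4 : Entry P k ι ℝ := fun t prev u' v _ _ => (R.O t).w4form (R.rf t prev u' v)

variable {terms : Finset ι}

/-- **(5.3.5) BY NAME on the read configuration**: `½⟨Λ₅′**f^{(k)}, σ_{k,loc}Λ₅′**f^{(k)}⟩ = 𝒬₁ + 𝒬′₁` (p02's `Ops.eq535_end` under its `Laws`).
[cite: BalabanImbrieJaffe1988, (5.3.5) p.280] -/
theorem gLHS_eq (hL : ∀ t ∈ terms, (R.O t).Laws) {t : ι} (ht : t ∈ terms) (prev : Prev P k) (u' : GaugeField P k U1)
    (v : GaugeField P (k+1) U1) (φ : HiggsField P k) (ψ : HiggsField P (k+1)) :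
    gLHS R t prev u' v = gQ1 R t prev u' v φ ψ + gQ1' R t prev u' v φ ψ :=
  (R.O t).eq535_end (hL t ht) _ _ _

/-- **(5.5.12) BY NAME on the read configuration**: `½⟨Λ₅′**f^{(k)}, σ_{k,loc}Λ₅′**f^{(k)}⟩ = 𝒬₁ + ½⟨Λ₁**∂A, σ∂A⟩ + ½⟨Λ₅′**f, σ^Lf⟩ + 𝒬₂ + 𝒬₃ +
⟨f, w₃A⟩ + ½⟨f, w₄f⟩` (p02's `Ops.eq5512` under its `Laws`). [cite: BalabanImbrieJaffe1988, (5.5.12) p.285] -/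
theorem gLHS_eq_5512 (hL : ∀ t ∈ terms, (R.O t).Laws) {t : ι} (ht : t ∈ terms) (prev : Prev P k) (u' : GaugeField P k U1)
    (v : GaugeField P (k+1) U1) (φ : HiggsField P k) (ψ : HiggsField P (k+1)) :
    gLHS R t prev u' v = gQ1 R t prev u' v φ ψ + gQuadA R t prev u' v φ ψ / 2 + gQuadF R t prev u' v φ ψ / 2 + gQ2 R t prev u' v φ ψ
      + gQ3 R t prev u' v φ ψ + gW3 R t prev u' v φ ψ + gW4 R t prev u' v φ ψ / 2 := by
  have h := (R.O t).eq5512 (hL t ht) (R.rg t prev u' v) (R.rA t prev u' v) (R.rf t prev u' v)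
  simp only [gLHS, rfk, rA', gQ1, gQuadA, gQuadF, gQ2, gQ3, gW3, gW4]
  rw [h]
  ring

/-- **The step (5.3.5) of (G) in the shape `h535` of `BIJ88Eq596Sectors.hG_of_steps`**, modulo the ONE reading identity `hread`: the
gauge-field quadratic form of (4.1) (any real-valued reading `G₀` of it — in `BIJ88Eq596Sectors`, `½·gaugeForm (T t) (cfg uOrig)`) equals
the carrier form `½⟨Λ₅′**f^{(k)}_{read}, σ_{k,loc}Λ₅′**f^{(k)}_{read}⟩` (the log-coordinate reading (5.3.2) of the plaquette variables after both
translations; row C2.Eq5.3.1-5.3.7) ⟹ `G₀ = 𝒬₁ + 𝒬′₁`. [cite: BalabanImbrieJaffe1988, (5.3.5) p.280] -/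
theorem h535_byName (hL : ∀ t ∈ terms, (R.O t).Laws) (G₀ : ι → Prev P k → GaugeField P k U1 → GaugeField P (k+1) U1 → ℝ)
    (hread : ∀ t ∈ terms, ∀ prev u' v, DeltaAx u' → G₀ t prev u' v = gLHS R t prev u' v) :
    ∀ t ∈ terms, ∀ prev u' v (φ : HiggsField P k) (ψ : HiggsField P (k+1)), DeltaAx u' →
      G₀ t prev u' v = gQ1 R t prev u' v φ ψ + gQ1' R t prev u' v φ ψ :=
  fun t ht prev u' v φ ψ hax => (hread t ht prev u' v hax).trans (gLHS_eq R hL ht prev u' v φ ψ)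

/-- **The step (5.5.12) of (G) in the shape `h5512` of `BIJ88Eq596Sectors.hG_of_steps`, BY NAME, no hypothesis beyond p02's `Laws`**:
`𝒬′₁ = ½⟨Λ₁**∂A, σ∂A⟩ + ½⟨Λ₅′**f, σ^Lf⟩ + 𝒬₂ + 𝒬₃ + ⟨f, w₃A⟩ + ½⟨f, w₄f⟩` at every read configuration (`eq5512` minus `eq535_end`).
[cite: BalabanImbrieJaffe1988, (5.5.12) p.285] -/
theorem h5512_byName (hL : ∀ t ∈ terms, (R.O t).Laws) :
    ∀ t ∈ terms, ∀ prev u' v (φ : HiggsField P k) (ψ : HiggsField P (k+1)), DeltaAx u' →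
      gQ1' R t prev u' v φ ψ = gQuadA R t prev u' v φ ψ / 2 + gQuadF R t prev u' v φ ψ / 2 + gQ2 R t prev u' v φ ψ
        + gQ3 R t prev u' v φ ψ + gW3 R t prev u' v φ ψ + gW4 R t prev u' v φ ψ / 2 := by
  intro t ht prev u' v φ ψ _
  have h1 := gLHS_eq R hL ht prev u' v φ ψ
  have h2 := gLHS_eq_5512 R hL ht prev u' v φ ψ
  linarith

end Gauge

/-! ## §2 (5.8.3): the scalar-sector entries from p02's §5.8 dictionary; (5.8.3) by name -/

section Scalar

variable {M N F : Type*} [NormedAddCommGroup M] [InnerProductSpace ℝ M] [NormedAddCommGroup N] [InnerProductSpace ℝ N]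
  [AddCommGroup F] [Module ℝ F]

variable (P k ι M N F) in
/-- **A reading of the scalar-field data of a term into p02's §5.8 dictionary**: the dictionary `O t {u^{(j)}} u^{(k)} v` of the term AT THE
CONFIGURATION (its operators `Δ_{k,loc}(ũ_{k+1})`, `P(ũ_{k+1})`, `C^{(k)}_{loc}(u_{k+1})`, `Q(ũ_{k+1})`, `Q_{k+1}(u_{k+1})`, `G^η_{k+1,loc}(u_{k+1})` depend on
the backgrounds `ũ_{k+1}`, `u_{k+1}` — (5.6.1), functions of `(u^{(k)}, v)`), and the maps reading `φ^{(k)}` into the unit-lattice carrier `M` and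
`ψ` into the block-lattice carrier `N` (real coordinates; `⟨f, g⟩ = Σ_y L^d f̄g` on `N` absorbed into `O.a` = the printed `aL⁻²`).
[cite: BalabanImbrieJaffe1988, (5.8.1) p.295] -/
structure ScalarReading where
  /-- the §5.8 operator dictionary of the term at the configuration -/
  O : ι → Prev P k → GaugeField P k U1 → GaugeField P (k+1) U1 → BIJ88ScalarSummary583.Ops M N F
  /-- `φ^{(k)}`, read on `M` -/
  rφ : ι → Prev P k → GaugeField P k U1 → GaugeField P (k+1) U1 → HiggsField P k → M
  /-- `ψ`, read on `N` -/
  rψ : ι → Prev P k → GaugeField P k U1 → GaugeField P (k+1) U1 → HiggsField P (k+1) → N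

variable (R : ScalarReading P k ι M N F)

/-- **the intermediate `mid2` of `BIJ88Eq596Sectors.hS_of_steps`** — the scalar quadratic forms of p. 295, *"½⟨Λ₈^{(k−1)′}φ, Δ_{k,loc}(ũ_{k+1})
Λ₈^{(k−1)′}φ⟩ + ½aL⁻²⟨ψ − Q(ũ_{k+1})φ, ψ − Q(ũ_{k+1})φ⟩"*, AT `φ = φ^{(k)} + Tψ` ((5.8.1), `T` = the dictionary's shift `Ops.T = aL⁻²Λ₇C_{loc}Q*`),
read (p02's `scalarForms`). [cite: BalabanImbrieJaffe1988, (5.8.1) p.295] -/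
def sMid2 : Entry P k ι ℝ := fun t prev u' v φ ψ =>
  scalarForms (R.O t prev u' v).a (R.O t prev u' v).Λ8 (R.O t prev u' v).Δ (R.O t prev u' v).Q
    (R.rφ t prev u' v φ + (R.O t prev u' v).T (R.rψ t prev u' v ψ)) (R.rψ t prev u' v ψ)

/-- entry `𝒬₄` of (5.9.6) ((5.8.2); p02's `Q4`), read. [cite: BalabanImbrieJaffe1988, (5.8.2) p.295] -/
def sQ4 : Entry P k ι ℝ := fun t prev u' v φ _ =>
  Q4 (R.O t prev u' v).a (R.O t prev u' v).Λ8 (R.O t prev u' v).P (R.rφ t prev u' v φ)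

/-- entry `𝒬₅` of (5.9.6) ((5.8.3); p02's `Ops.Q5`), read. [cite: BalabanImbrieJaffe1988, (5.8.3) p.296] -/
def sQ5 : Entry P k ι ℝ := fun t prev u' v φ ψ => (R.O t prev u' v).Q5 (R.rφ t prev u' v φ) (R.rψ t prev u' v ψ)

/-- entry `𝒬₆` of (5.9.6) ((5.8.3); p02's `Ops.Q6`), read. [cite: BalabanImbrieJaffe1988, (5.8.3) p.296] -/
def sQ6 : Entry P k ι ℝ := fun t prev u' v _ ψ => (R.O t prev u' v).Q6 (R.rψ t prev u' v ψ)

/-- entry `⟨Λ₈^{(k−1)′}φ^{(k)}, (Δ_{k,loc}(ũ_{k+1}) + aL⁻²P(ũ_{k+1}))Λ₈^{(k−1)′}φ^{(k)}⟩` of (5.9.6) ((5.8.2)), read.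
[cite: BalabanImbrieJaffe1988, (5.8.2) p.295] -/
def sQuadPhi : Entry P k ι ℝ := fun t prev u' v φ _ =>
  ⟪(R.O t prev u' v).Λ8 (R.rφ t prev u' v φ),
    (R.O t prev u' v).Δ ((R.O t prev u' v).Λ8 (R.rφ t prev u' v φ))
      + (R.O t prev u' v).a • (R.O t prev u' v).P ((R.O t prev u' v).Λ8 (R.rφ t prev u' v φ))⟫

/-- entry `⟨Λ₈^{(k)′}ψ, Δ^L_{k+1,loc}(u_{k+1})Λ₈^{(k)′}ψ⟩` of (5.9.6) ((5.8.3); `Δ^L_{k+1,loc}` = p02's `Ops.deltaLloc`), read.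
[cite: BalabanImbrieJaffe1988, (5.8.3) p.296] -/
def sQuadPsi : Entry P k ι ℝ := fun t prev u' v _ ψ =>
  ⟪(R.O t prev u' v).Λ8' (R.rψ t prev u' v ψ), (R.O t prev u' v).deltaLloc ((R.O t prev u' v).Λ8' (R.rψ t prev u' v ψ))⟫

/-- entry `⟨φ^{(k)}, w₆ψ⟩` of (5.9.6) ((5.8.3); p02's `Ops.w6`), read. [cite: BalabanImbrieJaffe1988, (5.8.3) p.296] -/
def sW6 : Entry P k ι ℝ := fun t prev u' v φ ψ => ⟪R.rφ t prev u' v φ, (R.O t prev u' v).w6 (R.rψ t prev u' v ψ)⟫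

/-- entry `⟨ψ, w₇ψ⟩` of (5.9.6) ((5.8.3); p02's `Ops.w7 = w₇′ + w₇″`), read. [cite: BalabanImbrieJaffe1988, (5.8.3) p.296] -/
def sW7 : Entry P k ι ℝ := fun t prev u' v _ ψ => ⟪R.rψ t prev u' v ψ, (R.O t prev u' v).w7 (R.rψ t prev u' v ψ)⟫

variable {terms : Finset ι}

/-- **The step (5.8.3) of (S) in the shape `h583` of `BIJ88Eq596Sectors.hS_of_steps`, BY NAME** (p02's `Ops.eq583` under its `Laws` at every
configuration): `mid2 = 𝒬₄ + 𝒬₅ + 𝒬₆ + ½⟨Λ₈′φ^{(k)}, (Δ + aL⁻²P)Λ₈′φ^{(k)}⟩ + ½⟨Λ₈′ψ, Δ^LΛ₈′ψ⟩ + ⟨φ^{(k)}, w₆ψ⟩ + ½⟨ψ, w₇ψ⟩`.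
[cite: BalabanImbrieJaffe1988, (5.8.3) p.296] -/
theorem h583_byName (hL : ∀ t ∈ terms, ∀ prev u' v, (R.O t prev u' v).Laws) :
    ∀ t ∈ terms, ∀ prev u' v (φ : HiggsField P k) (ψ : HiggsField P (k+1)), DeltaAx u' →
      sMid2 R t prev u' v φ ψ = sQ4 R t prev u' v φ ψ + sQ5 R t prev u' v φ ψ + sQ6 R t prev u' v φ ψ + sQuadPhi R t prev u' v φ ψ / 2
        + sQuadPsi R t prev u' v φ ψ / 2 + sW6 R t prev u' v φ ψ + sW7 R t prev u' v φ ψ / 2 := by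
  intro t ht prev u' v φ ψ _
  have h := (R.O t prev u' v).eq583 (hL t ht prev u' v) (R.rφ t prev u' v φ) (R.rψ t prev u' v ψ)
  simp only [sMid2, sQ4, sQ5, sQ6, sQuadPhi, sQuadPsi, sW6, sW7]
  rw [h]
  ring

end Scalar

/-! ## §3 The (5.9.6) table with the fourteen entries filled from the dictionaries -/

section Fill

variable {M : Type*} [NormedAddCommGroup M] [InnerProductSpace ℝ M]
variable {M' N' F' : Type*} [NormedAddCommGroup M'] [InnerProductSpace ℝ M'] [NormedAddCommGroup N'] [InnerProductSpace ℝ N']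
  [AddCommGroup F'] [Module ℝ F']

/-- **The transcribed table of (5.9.6) with the fourteen exponent entries of (5.5.12) and (5.8.3) FILLED from the operator dictionaries of
record** (the other entries — characteristic functions, `Πg_k`, `Π(F + F̃)`, `Π[ZZ]`, `ℰ_k`, `E^{(k)}`, `𝒫_{k,loc}`, `R^{(k)}`, `ΣW₁`, `Q^{(k)}`, `ΣW₂` —
are those of `D`). [cite: BalabanImbrieJaffe1988, (5.9.6) p.297] -/
def fillOps (D : Bracket596 P k ι) (RG : GaugeReading P k ι M) (RS : ScalarReading P k ι M' N' F') : Bracket596 P k ι :=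
  { D with
    quadA := gQuadA RG, quadF := gQuadF RG, Q1 := gQ1 RG, Q2 := gQ2 RG, Q3 := gQ3 RG, fw3A := gW3 RG, fw4f := gW4 RG,
    Q4 := sQ4 RS, Q5 := sQ5 RS, Q6 := sQ6 RS, quadPhi := sQuadPhi RS, quadPsi := sQuadPsi RS, phiW6Psi := sW6 RS, psiW7Psi := sW7 RS }

variable {terms : Finset ι} (D : Bracket596 P k ι) (RG : GaugeReading P k ι M) (RS : ScalarReading P k ι M' N' F')

/-- **For the filled table, hypothesis `h535` of `BIJ88Eq596Sectors.hG_of_steps` holds with `Q1' := gQ1' RG`, modulo the reading `hread`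
of (5.3.2)** (`h535_byName`). [cite: BalabanImbrieJaffe1988, (5.3.5) p.280] -/
theorem h535_fillOps (hL : ∀ t ∈ terms, (RG.O t).Laws) (G₀ : ι → Prev P k → GaugeField P k U1 → GaugeField P (k+1) U1 → ℝ)
    (hread : ∀ t ∈ terms, ∀ prev u' v, DeltaAx u' → G₀ t prev u' v = gLHS RG t prev u' v) :
    ∀ t ∈ terms, ∀ prev u' v (φ : HiggsField P k) (ψ : HiggsField P (k+1)), DeltaAx u' →
      G₀ t prev u' v = (fillOps D RG RS).Q1 t prev u' v φ ψ + gQ1' RG t prev u' v φ ψ :=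
  h535_byName RG hL G₀ hread

/-- **For the filled table, hypothesis `h5512` of `BIJ88Eq596Sectors.hG_of_steps` holds with `Q1' := gQ1' RG`, BY NAME** (`h5512_byName`).
[cite: BalabanImbrieJaffe1988, (5.5.12) p.285] -/
theorem h5512_fillOps (hL : ∀ t ∈ terms, (RG.O t).Laws) :
    ∀ t ∈ terms, ∀ prev u' v (φ : HiggsField P k) (ψ : HiggsField P (k+1)), DeltaAx u' → gQ1' RG t prev u' v φ ψ =
      (fillOps D RG RS).quadA t prev u' v φ ψ / 2 + (fillOps D RG RS).quadF t prev u' v φ ψ / 2 + (fillOps D RG RS).Q2 t prev u' v φ ψ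
        + (fillOps D RG RS).Q3 t prev u' v φ ψ + (fillOps D RG RS).fw3A t prev u' v φ ψ + (fillOps D RG RS).fw4f t prev u' v φ ψ / 2 :=
  h5512_byName RG hL

/-- **For the filled table, hypothesis `h583` of `BIJ88Eq596Sectors.hS_of_steps` holds with `mid2 := sMid2 RS`, BY NAME** (`h583_byName`).
[cite: BalabanImbrieJaffe1988, (5.8.3) p.296] -/
theorem h583_fillOps (hL : ∀ t ∈ terms, ∀ prev u' v, (RS.O t prev u' v).Laws) :
    ∀ t ∈ terms, ∀ prev u' v (φ : HiggsField P k) (ψ : HiggsField P (k+1)), DeltaAx u' → sMid2 RS t prev u' v φ ψ =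
      (fillOps D RG RS).Q4 t prev u' v φ ψ + (fillOps D RG RS).Q5 t prev u' v φ ψ + (fillOps D RG RS).Q6 t prev u' v φ ψ
        + (fillOps D RG RS).quadPhi t prev u' v φ ψ / 2 + (fillOps D RG RS).quadPsi t prev u' v φ ψ / 2
        + (fillOps D RG RS).phiW6Psi t prev u' v φ ψ + (fillOps D RG RS).psiW7Psi t prev u' v φ ψ / 2 :=
  h583_byName RS hL

end Fill

/-! ## §4 (5.6.13): the expansion entries `R^{(k)}`, `Σ_□W₁^{(k)}(□)` from p31's Taylor bookkeeping; (5.6.13) by name -/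

section Expansion

open BIJ88TaylorSplit5614 (Rtilde)
open BIJ88Eq5613Summary (W1 eq5613)

variable (P k ι) in
/-- **A reading of the Sect. 5.6 expansion data of a term**: p. 287 *"We take terms which came from the original expressions F_{k,loc},
⟨ψ − Q(u_k)φ, ψ − Q(u_k)φ⟩, ⟨Λ₈^{(k−1)′}φ, Δ_{k,loc}(u_k)Λ₈^{(k−1)′}φ⟩, and 𝒫_{k,loc}(Λ₈^{(k−1)}), and write the background field as ũ_{k+1}ũ =
ũ_{k+1} exp ie_kη[θ_kH_{k,loc}A^{(k)} + w₁A′]"* — at each configuration: `Sphys` = the physical value of the three scalar expressions (left side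
of (5.6.13)), `F` = their interpolating family `e′ ↦ (…)(ũ_{k+1}e^{ie′e_kηθ_kH_{k,loc}A^{(k)}}, …)` of (5.6.14) (so `F 0` = the expressions at the
background `ũ_{k+1}`), `nbar` = the order `n̄`, `δR` = the localization correction `R̃^{(k)} − R^{(k)}` (p. 288: *"R^{(k)} can be obtained by
replacing propagators G_k(□, ũ_{k+1}) with G_{k,loc}(ũ_{k+1}) …"*); p31's `BIJ88Eq5613Summary` bookkeeping. [cite: BalabanImbrieJaffe1988, (5.6.13) p.288] -/
structure ExpansionReading where
  /-- the physical value of `½aL⁻²|ψ̃ − Q(u′_k)φ̃|² + ½⟨Λ₈′φ̃, Δ_{k,loc}(u′_k)Λ₈′φ̃⟩ + 𝒫_{k,loc}(Λ₈′φ̃, u′_k)` at the configuration -/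
  Sphys : Entry P k ι ℝ
  /-- the interpolating family in `e′` of (5.6.14) -/
  F : ι → Prev P k → GaugeField P k U1 → GaugeField P (k+1) U1 → HiggsField P k → HiggsField P (k+1) → ℝ → ℝ
  /-- the order `n̄` of the expansion -/
  nbar : ℕ
  /-- the localization correction `R̃^{(k)} − R^{(k)}` -/
  δR : Entry P k ι ℝ

variable (R : ExpansionReading P k ι)

/-- entry `R^{(k)}(u_{k+1}, θ_kH_{k,loc}A^{(k)})` of (5.9.6): `R̃^{(k)} − δR` with `R̃^{(k)}` the order-`≤ n̄` Taylor part (5.6.14) of the family (p31's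
`Rtilde`). [cite: BalabanImbrieJaffe1988, (5.6.14) p.288] -/
def eRk : Entry P k ι ℝ := fun t prev u' v φ ψ => Rtilde (R.F t prev u' v φ ψ) R.nbar - R.δR t prev u' v φ ψ

/-- entry `Σ_□W₁^{(k)}(□)` of (5.9.6): p31's `W1` (the phase-factor, `w₁`, order-`> n̄` and localization leftovers, `W1_eq_sources`).
[cite: BalabanImbrieJaffe1988, (5.6.13) p.288] -/
def eW1 : Entry P k ι ℝ := fun t prev u' v φ ψ =>
  W1 (R.Sphys t prev u' v φ ψ) (R.F t prev u' v φ ψ) R.nbar (R.δR t prev u' v φ ψ)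

variable {terms : Finset ι}

/-- **The step (5.6.13) of (S) in the shape `h5613` of `BIJ88Eq596Sectors.hS_of_steps`, BY NAME** (p31's `BIJ88Eq5613Summary.eq5613`), modulo
the ONE reading identity `hreadS`: the value `F 0` of the family at `e′ = 0` — the three expressions at the background `ũ_{k+1}` — is the
(5.8.1)-read scalar quadratic forms `mid2` plus the entry `𝒫_{k,loc}(Λ₈^{(k−1)}, ũ_{k+1})` (rows C2.Eq5.6.13 / C2.Eq5.8.1-5.8.3).  Conclusion:
`Sphys = mid2 + 𝒫_{k,loc} + R^{(k)} + Σ_□W₁`. [cite: BalabanImbrieJaffe1988, (5.6.13) p.288] -/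
theorem h5613_byName (mid2 Pkloc : Entry P k ι ℝ)
    (hreadS : ∀ t ∈ terms, ∀ prev u' v φ ψ, DeltaAx u' → R.F t prev u' v φ ψ 0 = mid2 t prev u' v φ ψ + Pkloc t prev u' v φ ψ) :
    ∀ t ∈ terms, ∀ prev u' v (φ : HiggsField P k) (ψ : HiggsField P (k+1)), DeltaAx u' →
      R.Sphys t prev u' v φ ψ = mid2 t prev u' v φ ψ + Pkloc t prev u' v φ ψ + eRk R t prev u' v φ ψ + eW1 R t prev u' v φ ψ := by
  intro t ht prev u' v φ ψ hax
  have h := eq5613 (R.Sphys t prev u' v φ ψ) (R.F t prev u' v φ ψ) R.nbar (R.δR t prev u' v φ ψ)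
  rw [eRk, eW1, ← hreadS t ht prev u' v φ ψ hax]
  linarith

end Expansion

/-! ## §5 (5.7.13): the normalization entries `Π[ZZ(u_{k+1})]`, `Q^{(k)} + Σ_XW₂^{(k)}(X)` from p13's Gaussian families; (5.7.13) by name -/

section Normalization

open BIJ88PertQ5715 (Zloc pertQ5715 remW5713 eq5713_main_of_entries)

variable {nZ : Fin k → Type} [∀ j, Fintype (nZ j)] [∀ j, DecidableEq (nZ j)]

variable (P k ι nZ) in
/-- **A reading of the Sect. 5.7 normalization data of a term**: for each previous step `j < k` a smooth family `e′ ↦ M_j(e′)` of positive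
Gaussian quadratic forms at the configuration (on the finite index type `nZ j` of the `j`-th factor's Gaussian variables) — p. 295
*"Π_{j=0}^{k−1}Z^{(j)}_{Λ₁₀^{(j)}}(u_{k+1}ũ̃)"* interpolated to `Π_jZ^{(j)}(u_{k+1})` (p13's `BIJ88PertQ5715.Zloc (M_j) e′`), the numerical factors
`Z^{(j)}_{Λ₁₀^{(j)c*c}}` ((4.6)), and the order `n̄`. [cite: BalabanImbrieJaffe1988, (5.7.13) p.295] -/
structure ZReading where
  /-- the interpolating quadratic forms `M_j(e′)` at the configuration -/
  Mf : (j : Fin k) → ι → Prev P k → GaugeField P k U1 → GaugeField P (k+1) U1 → ℝ → Matrix (nZ j) (nZ j) ℝ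
  /-- the numerical factors `Z^{(j)}_{Λ₁₀^{(j)c*c}}` -/
  Zv : ι → Fin k → ℝ
  /-- the order `n̄` -/
  nbar : ℕ

variable (R : ZReading P k ι nZ)

/-- entry `Π_{j=0}^{k−1}[Z^{(j)}_{Λ₁₀^{(j)c*c}}Z^{(j)}_{Λ₁₀^{(j)}}(u_{k+1})]` of (5.9.6): the families at `e′ = 0`. [cite: BalabanImbrieJaffe1988, (5.7.13) p.295] -/
def zZf : Entry P k ι ℝ := fun t prev u' v _ _ => ∏ j, R.Zv t j * Zloc (R.Mf j t prev u' v) 0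

/-- entry `Q^{(k)} + Σ_XW₂^{(k)}(X)` of (5.9.6): the sum over `j` of p13's (5.7.15) expansions and (5.7.13) remainders of the families.
[cite: BalabanImbrieJaffe1988, (5.7.13) p.295] -/
def zQW : Entry P k ι ℝ := fun t prev u' v _ _ =>
  ∑ j, (pertQ5715 (R.Mf j t prev u' v) R.nbar + remW5713 (R.Mf j t prev u' v) R.nbar)

/-- kernel: a product of per-factor identities `Z_j(1) = Z_j(0)e^{x_j}` gives `Π_j c_jZ_j(1) = (Π_j c_jZ_j(0))e^{Σ_jx_j}`.
[cite: BalabanImbrieJaffe1988, (5.7.13) p.295] -/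
private theorem prod_mul_exp {m : ℕ} (c Z1 Z0 x : Fin m → ℝ) (h : ∀ j, Z1 j = Z0 j * Real.exp (x j)) :
    ∏ j, c j * Z1 j = (∏ j, c j * Z0 j) * Real.exp (∑ j, x j) := by
  rw [Real.exp_sum, ← Finset.prod_mul_distrib]
  exact Finset.prod_congr rfl fun j _ => by rw [h j, mul_assoc]

variable {terms : Finset ι}

/-- **The step (5.7.13) of (Z) in the shape `h5713` of `BIJ88Eq596Sectors.hZ_of_steps`, BY NAME** (p13's `BIJ88PertQ5715.eq5713_main_of_entries`
for every factor: `M_j` positive definite on `[0, 1]` with `C^{n̄+1}` entries): with `Zmid := Π_j[Z^{(j)}_vZ_j(1)]` (the normalization factors at the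
gauge-transformed background `u_{k+1}ũ̃`, p. 283 *"We can gauge away the term ∂C_kΛ₃^{(k)*}A′"* — the reading `hgauge` of `hZ_of_steps`),
`Zmid = Π[ZZ(u_{k+1})]·exp[−(Q^{(k)} + ΣW₂)]`. [cite: BalabanImbrieJaffe1988, (5.7.13) p.295] -/
theorem h5713_byName
    (hM : ∀ t ∈ terms, ∀ j prev u' v, ∀ e' ∈ Set.uIcc (0 : ℝ) 1, (R.Mf j t prev u' v e').PosDef)
    (hC : ∀ t ∈ terms, ∀ j prev u' v, ∀ i i', ContDiffOn ℝ (R.nbar + 1 : ℕ) (fun e' => R.Mf j t prev u' v e' i i') (Set.uIcc 0 1)) :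
    ∀ t ∈ terms, ∀ prev u' v (φ : HiggsField P k) (ψ : HiggsField P (k+1)), DeltaAx u' →
      (∏ j, R.Zv t j * Zloc (R.Mf j t prev u' v) 1) = zZf R t prev u' v φ ψ * Real.exp (-(zQW R t prev u' v φ ψ)) := by
  intro t ht prev u' v φ ψ _
  rw [zZf, zQW, ← Finset.sum_neg_distrib]
  refine prod_mul_exp _ _ _ _ fun j => ?_
  rw [eq5713_main_of_entries (R.Mf j t prev u' v) (hM t ht j prev u' v) (hC t ht j prev u' v)]
  congr 1
  ring_nf

end Normalization

end

end Literature.MathematicalPhysics.QuantumFieldTheory.BalabanImbrieJaffe1984to88.BIJ88Eq596SlotsByName
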